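import Summits.QuantumFields.BalabanUV.Beta.FP.TadpoleFreeVertex
import Summits.QuantumFields.BalabanUV.Beta.FP.RoadEndLeftUndressed
import Summits.QuantumFields.BalabanUV.Beta.FP.PerfectJetLetters
import Summits.QuantumFields.BalabanUV.Beta.FP.SymmetryK

/-!
# `BalabanUV.Beta.FP.TadpoleFreePerfect` — road «FP» for binder row D1, PROPOSED RULING R-FP-46 row **TAD-INST** (OWNER d1-p3 g15, journal l.34368 (C): «instance line:
# first refusal leaf-02 ∕ leaf-05; S»): THE ONE-POINT FUNCTION OF THE LITERAL's PERFECT ONE-STEP SYSTEM VANISHES —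
# `tadpole (KPerf 1) (vertexOfK (KPerf 1) Lc (SPerfOf … (JsB12Sym …).S 1) μ y) = 0` — from the owner's `TadpoleFreeVertex.tadpole_vertexOfK_KPerf_one_eq_zero` with its
# three stencil letters DISCHARGED down to: the END's (CONV-C) S-rows of the UNDRESSED literal (row G-an2-4, HYPOTHESES as everywhere), an2's (St) law (unconditional),
# and the literal's finite-`j` (Sr) reflection law (DISPLAYED in the exact shape the (Sr-conj) courier chain types)

HONEST DEPENDENCY (page 1, mandatory): continuum YM on T⁴ ⇐ BetaPertH ∧ nine spine estimates (0/9 proved); BetaPertH ⇐ (D1) ∧ (D4) ∧ CAP+tail;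
G-an2-4 gates asym, D1 and NE2/3/4.  HONEST FRAMING (cell contract, verbatim): «discharging `BetaPertH` makes Bałaban's UV stability UNCONDITIONAL —
a real constructive-QFT result; it is NOT the continuum limit and NOT the Clay problem.»  THIS MODULE DISCHARGES NOTHING of the wall: [folklore] bookkeeping BY NAME —
`TadpoleFreeVertex` (owner), `RoadEndLeftUndressed.sRow(All)_JsB12Sym_of_undressed` ∕ `JsB12Sym_S_translate` (leaf-06 g11 ∕ an2), `PerfectJetLetters.locStencil_sPerf_of_rows` ∕
`sPerf_cov_of_members` (owner), `SymmetryK` (leaf-06: `refK_limMKerOf_of_exists_tendsto`, `limMKerOf_smul_of_exists_tendsto`, `refK_counitK`, `counitK_smul`, `refK_smul`),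
`HessKerDressedLimit.tendsto_lim_of_weighted` (asym1).  No `def`, no `def … : Prop`, nothing cited, 0 sorry; 0 estimates; 0∕4 row-D1 binders; NOT (CONV-C), NOT (Sr) for the
literal, NOT SDF, NOT D1, NOT BetaPertH, NOT continuum, NOT Clay.  «not in print; our bookkeeping».

ABSOLUTE RULE (cell charter, verbatim): «No internally-minted statement may enter as a cited fact. Every hypothesis is either kernel-proved in this package or a
verbatim quotation of a PUBLISHED theorem with page reference. The manuscript(s) under audit are NOT citable for their own disputed steps — they are the thing
under adjudication; programme-internal (2001/route/tribunal) claims are never citable.»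

WHY (R-FP-46 (A)(B)(D)): under R-FP-45 (B) the END's step defect is `D m = Σ_{b₁} T₁(b₁)·R^c_m(b₁; ·)` with `T₁(b₁) := ½·tadpole (KPerf 1) (vertexOfK (KPerf 1) Lc S∞ b₁)` the
one-point function of the literal's perfect one-step system; TAD-FREE kills it: `hSDF ⟸` (St♭)(Sr) of the literal's stencil + kernel algebra (W-ORACLE-K, owner).  This file is the
TAD-INST line: `T₁ ≡ 0` for the literal `JsB12Sym`, with every stencil letter of the owner's generic theorem traced to an existing row or law.

CONTENTS.
* §1 [folklore] generic: `exists_tendsto_of_locStencil_allScales` (all-scales `LocStencil` deviations with `θ < 1` ⟹ every entry of the unit-rescaled members converges),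
  **`sPerf_reflect_of_rows`** ((Sr) with a bond-index-dependent bond map ∕ sign passes to `SPerfOf` through the units and the constructed limit).
* §2 [our object — bookkeeping] **`tadpole_KPerf_one_JsB12Sym_eq_zero`** — THE TAD-INST LINE.
Provenance: D1 formalisation swarm LEAF PROVER 02, unit b2b-balaban-beta-d1-formalise-leaf-02 gen 14, 2026-08-21; R-FP-46 (C) first refusal; MINE W-d1leaf02g14-1 on R-FP-46.
-/

noncomputable section

namespace Summit.QuantumFields.BalabanUV.Beta.FP.TadpoleFreePerfect

open Filter
open scoped Topology
open Literature.MathematicalPhysics.QuantumFieldTheory.Balaban1983to89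
open Literature.MathematicalPhysics.QuantumFieldTheory.Balaban1983to89.Beta
open ExpKernelCalculus (Site MKer tadpole shiftK)
open PolarizationSign (reflSign)
open KernelReflection (refK LegMap refK_apply)
open ResolventReflection (Φ bref)
open OneStepResolventKernel (Fib LocStencil)
open OneStepKernelFamily (vertexOfK)
open HessKerDressedLimit (limStOf limStOf_apply limMKerOf tendsto_lim_of_weighted)
open Summit.QuantumFields.BalabanUV.Beta.HessKerDressedUnits (unitS counitK)
open Summit.QuantumFields.BalabanUV.Beta.SymmetrisedStepJets (SymTables JsB12Sym0 JsB12Sym)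
open Summit.QuantumFields.BalabanUV.Beta.GAN24.CombesThomas (sfStep smStep)
open Summit.QuantumFields.BalabanUV.Beta.FP.PerfectObjectsT (KPerf SPerfOf)
open Summit.QuantumFields.BalabanUV.Beta.FP.PerfectJetLetters (locStencil_sPerf_of_rows sPerf_cov_of_members)
open Summit.QuantumFields.BalabanUV.Beta.FP.RoadEndLeftUndressed (sRow_JsB12Sym_of_undressed sRowAll_JsB12Sym_of_undressed JsB12Sym_S_translate)
open Summit.QuantumFields.BalabanUV.Beta.FP.SymmetryK (refK_limMKerOf_of_exists_tendsto limMKerOf_smul_of_exists_tendsto refK_counitK counitK_smul refK_smul)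
open Summit.QuantumFields.BalabanUV.Beta.FP.TadpoleFreeVertex (tadpole_vertexOfK_KPerf_one_eq_zero)

/-! ## §1 (Sr) passes to the perfect stencil under the (CONV-C) rows -/

section Generic

variable {d : ℕ}

/-- [folklore] **ALL-SCALES `LocStencil` DEVIATIONS ⟹ ENTRYWISE CONVERGENCE**: if `LocStencil (T (k+j) − T k) (c·θ^k) δ` for all `k j` with `θ < 1`, every entry of the
members converges (to the constructed limit; asym1's `tendsto_lim_of_weighted`). -/
theorem exists_tendsto_of_locStencil_allScales {T : ℕ → Fin (d + 1) → (Fin (d + 1) → ℤ) → MKer (d + 1) (Fib d)} {c δ θ : ℝ}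
    (hall : ∀ k j, LocStencil (T (k + j) - T k) (c * θ ^ k) δ) (hθ1 : θ < 1)
    (κ : Fin (d + 1)) (u x y : Fin (d + 1) → ℤ) (a b : Fib d) : ∃ L : ℝ, Tendsto (fun j => T j κ u x y a b) atTop (𝓝 L) :=
  ⟨_, tendsto_lim_of_weighted (t := fun j => T j κ u x y a b)
    (fun k j => by simpa only [Pi.sub_apply] using hall k j κ u x y a b) hθ1⟩

/-- [folklore] **(Sr) PASSES TO THE PERFECT STENCIL** `SPerfOf sf sm S m = limStOf (j ↦ unitS (sf j) (sm j) (S j m))`: a finite-`j` reflection law with a bond-INDEX-DEPENDENT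
bond map `ρ κ` and sign `c κ` survives the units (`refK_counitK`, `counitK_smul`, `refK_smul` — leaf-06's `unitS_reflect` inlined for index-dependent data) and the constructed
limit of an entrywise CONVERGENT family (`refK_limMKerOf_of_exists_tendsto`, `limMKerOf_smul_of_exists_tendsto`). -/
theorem sPerf_reflect_of_rows (sf sm : ℕ → ℝ) (S : ℕ → ℕ → Fin (d + 1) → (Fin (d + 1) → ℤ) → MKer (d + 1) (Fib d)) (m : ℕ) (Ψ : LegMap (d + 1) (Fib d))
    {ρ : Fin (d + 1) → (Fin (d + 1) → ℤ) → (Fin (d + 1) → ℤ)} {c : Fin (d + 1) → ℝ}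
    (hconv : ∀ κ u x y a b, ∃ L : ℝ, Tendsto (fun j => unitS (sf j) (sm j) (S j m) κ u x y a b) atTop (𝓝 L))
    (h : ∀ j κ u, S j m κ (ρ κ u) = c κ • refK Ψ (S j m κ u)) (κ : Fin (d + 1)) (u : Fin (d + 1) → ℤ) :
    SPerfOf sf sm S m κ (ρ κ u) = c κ • refK Ψ (SPerfOf sf sm S m κ u) := by
  -- the finite-`j` law for the unit-rescaled members
  have hu : ∀ j, unitS (sf j) (sm j) (S j m) κ (ρ κ u) = c κ • refK Ψ (unitS (sf j) (sm j) (S j m) κ u) := by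
    intro j
    simp only [unitS]
    rw [h j κ u, counitK_smul, refK_smul, refK_counitK]
    exact smul_comm _ _ _
  have hconv' : ∀ x y a b, ∃ L : ℝ, Tendsto (fun j => unitS (sf j) (sm j) (S j m) κ u x y a b) atTop (𝓝 L) := hconv κ u
  have hconvR : ∀ x y a b, ∃ L : ℝ, Tendsto (fun j => refK Ψ (unitS (sf j) (sm j) (S j m) κ u) x y a b) atTop (𝓝 L) := by
    intro x y a b
    obtain ⟨L, hL⟩ := hconv' (Ψ.r a x) (Ψ.r b y) a b
    exact ⟨_, by simpa only [refK_apply] using hL.const_mul (Ψ.s a * Ψ.s b)⟩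
  unfold SPerfOf
  rw [limStOf_apply, limStOf_apply, funext hu, limMKerOf_smul_of_exists_tendsto (c κ) hconvR,
    ← refK_limMKerOf_of_exists_tendsto Ψ hconv']

end Generic

/-! ## §2 TAD-INST: the literal's perfect one-step tadpole vanishes -/

section Literal

variable {Lc : ℕ} [NeZero Lc] (hOdd : Odd Lc) (Ncol : ℕ) (tabs : SymTables 3 Lc) (cΛ cB : ℝ)

/-- [our object — bookkeeping] **TAD-INST FOR THE LITERAL OF RECORD** (`d = 3`, `Odd Lc`, `2 ≤ Lc`, adopted units): the one-point function of the perfect one-step system of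
`JsB12Sym` VANISHES — `tadpole (KPerf 1) (vertexOfK (KPerf 1) Lc (SPerfOf (sfStep Lc) (smStep 3 Lc) (j ↦ (JsB12Sym … j).S) 1) μ y) = 0` for every coarse bond `(μ, y)`.
HYPOTHESES, each traced: the (CONV-C) S-rows `hS0`∕`hSall0` of the UNDRESSED unit-rescaled stencils (row G-an2-4 — EXACTLY the END's, `RoadLeftLiteralWardTables`) with `0 < δS`,
`θS < 1` ⟹ (via `sRow(All)_JsB12Sym_of_undressed` + `locStencil_sPerf_of_rows`) the locality letter and (via §1) the convergence; the literal's (St) is an2's THEOREM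
(`JsB12Sym_S_translate` ⟹ `sPerf_cov_of_members`); the finite-`j` (Sr) reflection law `hSr` of the literal's stencils — DISPLAYED in the (Sr-conj) chain's shape (an1 ∕ leaf-05
couriers); the kernel side is UNCONDITIONAL inside the owner's theorem (`SymmetryKHolds.kernelSide_KPerf_one_holds`). -/
theorem tadpole_KPerf_one_JsB12Sym_eq_zero (hL2 : 2 ≤ Lc) {Cs0 cS δS θS : ℝ}
    (hS0 : ∀ j, LocStencil (unitS (sfStep Lc j) (smStep 3 Lc j) (JsB12Sym0 hOdd Ncol tabs cΛ cB j).S) Cs0 δS)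
    (hSall0 : ∀ k j, LocStencil (unitS (sfStep Lc (k + j)) (smStep 3 Lc (k + j)) (JsB12Sym0 hOdd Ncol tabs cΛ cB (k + j)).S -
      unitS (sfStep Lc k) (smStep 3 Lc k) (JsB12Sym0 hOdd Ncol tabs cΛ cB k).S) (cS * θS ^ k) δS)
    (hδS : 0 < δS) (hθS1 : θS < 1)
    (hSr : ∀ (j : ℕ) (α κ' : Fin (3 + 1)) (u : Fin (3 + 1) → ℤ),
      (JsB12Sym hOdd Ncol tabs cΛ cB j).S κ' (bref α κ' u) = reflSign α κ' • refK (Φ (d := 3) Lc α) ((JsB12Sym hOdd Ncol tabs cΛ cB j).S κ' u))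
    (μ : Fin (3 + 1)) (y : Fin (3 + 1) → ℤ) :
    tadpole (KPerf (d := 3) Lc (sfStep Lc) (smStep 3 Lc) 1)
      (vertexOfK (KPerf (d := 3) Lc (sfStep Lc) (smStep 3 Lc) 1) Lc
        (SPerfOf (sfStep Lc) (smStep 3 Lc) (fun j _ => (JsB12Sym hOdd Ncol tabs cΛ cB j).S) 1) μ y) = 0 := by
  -- the rows of the DRESSED literal from the undressed ones
  have hS := sRow_JsB12Sym_of_undressed hOdd Ncol tabs cΛ cB (sfStep Lc) (smStep 3 Lc) hδS.le hS0
  have hSall := sRowAll_JsB12Sym_of_undressed hOdd Ncol tabs cΛ cB (sfStep Lc) (smStep 3 Lc) hδS hS0 hSall0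
  -- locality of the perfect stencil
  have hloc := locStencil_sPerf_of_rows (sfStep Lc) (smStep 3 Lc) (fun j _ => (JsB12Sym hOdd Ncol tabs cΛ cB j).S) 1 hS hSall hθS1
  -- (St) of the perfect stencil (unconditional)
  have hSt : ∀ (κ' : Fin (3 + 1)) (u t : Fin (3 + 1) → ℤ),
      SPerfOf (sfStep Lc) (smStep 3 Lc) (fun j _ => (JsB12Sym hOdd Ncol tabs cΛ cB j).S) 1 κ' (u + (Lc : ℤ) • t)
        = shiftK (-((Lc : ℤ) • t)) (SPerfOf (sfStep Lc) (smStep 3 Lc) (fun j _ => (JsB12Sym hOdd Ncol tabs cΛ cB j).S) 1 κ' u) :=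
    fun κ' u t => sPerf_cov_of_members (sfStep Lc) (smStep 3 Lc) (fun j _ => (JsB12Sym hOdd Ncol tabs cΛ cB j).S) 1 (Lc : ℤ)
      (fun j κ u t => JsB12Sym_S_translate hOdd Ncol tabs cΛ cB j κ u t) κ' u t
  -- (Sr) of the perfect stencil from the finite-`j` law and the convergence the rows give
  have hconv := exists_tendsto_of_locStencil_allScales
    (T := fun j => unitS (sfStep Lc j) (smStep 3 Lc j) (JsB12Sym hOdd Ncol tabs cΛ cB j).S) hSall hθS1
  have hSr' : ∀ (α κ' : Fin (3 + 1)) (u : Fin (3 + 1) → ℤ),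
      SPerfOf (sfStep Lc) (smStep 3 Lc) (fun j _ => (JsB12Sym hOdd Ncol tabs cΛ cB j).S) 1 κ' (bref α κ' u)
        = reflSign α κ' • refK (Φ (d := 3) Lc α) (SPerfOf (sfStep Lc) (smStep 3 Lc) (fun j _ => (JsB12Sym hOdd Ncol tabs cΛ cB j).S) 1 κ' u) :=
    fun α κ' u => sPerf_reflect_of_rows (sfStep Lc) (smStep 3 Lc) (fun j _ => (JsB12Sym hOdd Ncol tabs cΛ cB j).S) 1 (Φ (d := 3) Lc α)
      (ρ := fun κ' => bref α κ') (c := fun κ' => reflSign α κ') hconv (fun j κ' u => hSr j α κ' u) κ' u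
  exact tadpole_vertexOfK_KPerf_one_eq_zero hL2 hloc hδS hSt hSr' μ y

end Literal

end Summit.QuantumFields.BalabanUV.Beta.FP.TadpoleFreePerfect

end
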